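import Literature.Topology.FourManifolds.CappellShanesonClassGroupTwentyeight
import Literature.Topology.FourManifolds.CappellShanesonClassGroupTwentyeightCls
import Literature.Topology.FourManifolds.CappellShanesonTotallyReal
import Literature.Topology.FourManifolds.CappellShanesonClassGroupTwelve
import Literature.Topology.FourManifolds.CappellShanesonClassGroupFifteen
import HarnessLib

/-!
# Trace `28`: the class group, the cover of `C(ℤ[Θ₂₈])`, Gompf's conjecture for the traces `28` and `-23`

Part 'Main' of the certified class-group computation for the trace `28` field behind
Kim–Yamada's Theorem B (`GompfConjectureForTrace 28` and, by Theorem A, `-23`), serving the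
named fact
`Literature.Topology.FourManifolds.kimYamada2023_nonempty_diffeomorph_sphere_four_of_trace_mem_Icc`
(`CappellShaneson.lean`; M. H. Kim, S. Yamada, Kyungpook Math. J. 63 (2023) 373–411 =
arXiv:1707.03860, Cor. C). The computation is split over several files only because of the
proposal size limit: `…ClassGroupTwentyeight.lean` (discriminant, `𝓞 K = ℤ[θ]`, the primes of small norm), `…ClassGroupTwentyeightRel<k>.lean` (two-ideal relations with certified generators and the non-vanishing of the generators), `…ClassGroupTwentyeightCls.lean` (the class of every small prime in terms of the generator(s), the order relations), `…ClassGroupTwentyeightMain.lean` (generation of the class group by Minkowski's bound, the cover of `C(ℤ[Θ])` by standard-matrix representatives, Gompf's conjecture for the two traces). (File generated from a certified computation; every relation is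
checked by the Lean kernel; no named fact is introduced, D-0026.)

## References

* [KimYamada2023] M. H. Kim, S. Yamada, Kyungpook Math. J. 63 (2023) 373–411 (arXiv:1707.03860):
  §2.3 (Prop. 2.14), §6.1 (Lemma 6.1 and the proof of Thm. B), Thm. A.
* [Marcus2018] D. A. Marcus, *Number Fields*, 2nd ed., Ch. 3, Thm. 27 (Dedekind–Kummer); Ch. 5,
  Cor. 2 of Thm. 37 (Minkowski bound) and the class-group computations after it.
-/

noncomputable section

open Set Polynomial Module NumberField Ideal
open scoped NumberField MatrixGroups nonZeroDivisors
open Literature.LinearAlgebra.Matrix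

namespace Literature.Topology.FourManifolds

section Field

variable {K : Type*} [Field K] [NumberField K] {θ : K}

set_option maxHeartbeats 2000000 in
/-- **Every ideal class of the trace `28` field is a power `aʳ`, `0 ≤ r < 10`, of `a = [(3, θ - 2)]`,
represented by the ideals listed** (so the class number divides `10`). Proof: `d_K = 418577`,
`⌊M_K⌋ ≤ 143`, Dedekind–Kummer at `p ≤ 143`, and the class of every small prime computed above
from two-ideal relations with certified generators. [cite: KimYamada2023, §6.1 (proof of Thm. B)] -/
theorem classGroup_mem_twentyeight (hθ : aeval θ (csPoly 28) = 0) (h3 : finrank ℚ K = 3)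
    (C : ClassGroup (𝓞 K)) :
    C = 1 ∨
      C = ClassGroup.mk0 ⟨span {(3 : 𝓞 K), thetaInt hθ - 2}, (span_pair_ofNat_mem_nonZeroDivisors (nat_lit 3) (thetaInt hθ - 2))⟩ ∨
      C = ClassGroup.mk0 ⟨span {(29 : 𝓞 K), thetaInt hθ - 3}, (span_pair_ofNat_mem_nonZeroDivisors (nat_lit 29) (thetaInt hθ - 3))⟩ ∨
      C = ClassGroup.mk0 ⟨span {(29 : 𝓞 K), thetaInt hθ - 18}, (span_pair_ofNat_mem_nonZeroDivisors (nat_lit 29) (thetaInt hθ - 18))⟩ ∨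
      C = ClassGroup.mk0 ⟨span {(7 : 𝓞 K), thetaInt hθ - 5}, (span_pair_ofNat_mem_nonZeroDivisors (nat_lit 7) (thetaInt hθ - 5))⟩ ∨
      C = ClassGroup.mk0 ⟨span {(19 : 𝓞 K), thetaInt hθ - 16}, (span_pair_ofNat_mem_nonZeroDivisors (nat_lit 19) (thetaInt hθ - 16))⟩ ∨
      C = ClassGroup.mk0 ⟨span {(19 : 𝓞 K), thetaInt hθ - 13}, (span_pair_ofNat_mem_nonZeroDivisors (nat_lit 19) (thetaInt hθ - 13))⟩ ∨
      C = ClassGroup.mk0 ⟨span {(23 : 𝓞 K), thetaInt hθ - 19}, (span_pair_ofNat_mem_nonZeroDivisors (nat_lit 23) (thetaInt hθ - 19))⟩ ∨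
      C = ClassGroup.mk0 ⟨span {(5 : 𝓞 K), thetaInt hθ - 3}, (span_pair_ofNat_mem_nonZeroDivisors (nat_lit 5) (thetaInt hθ - 3))⟩ ∨
      C = ClassGroup.mk0 ⟨span {(17 : 𝓞 K), thetaInt hθ - 2}, (span_pair_ofNat_mem_nonZeroDivisors (nat_lit 17) (thetaInt hθ - 2))⟩ := by
  classical
  obtain ⟨a, ha⟩ : ∃ a : ClassGroup (𝓞 K), ClassGroup.mk0 ⟨span {(3 : 𝓞 K), thetaInt hθ - 2}, (span_pair_ofNat_mem_nonZeroDivisors (nat_lit 3) (thetaInt hθ - 2))⟩ = a := ⟨_, rfl⟩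
  have ham : a ^ (10 : ℤ) = 1 := by rw [← ha]; exact pow_order_twentyeight hθ
  let H : Subgroup (ClassGroup (𝓞 K)) := Subgroup.zpowers a
  have hprinc : ∀ (P : Ideal (𝓞 K)) (hP0 : P ∈ (Ideal (𝓞 K))⁰) (x : 𝓞 K), P = span {x} →
      ClassGroup.mk0 ⟨P, hP0⟩ ∈ H := by
    intro P hP0 x hPx
    have : ClassGroup.mk0 ⟨P, hP0⟩ = 1 :=
      (ClassGroup.mk0_eq_one_iff hP0).mpr ⟨⟨x, by rw [hPx, submodule_span_eq]⟩⟩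
    rw [this]
    exact H.one_mem
  -- Minkowski: `⌊M_K⌋ ≤ 143`
  have hd : ((|NumberField.discr K| : ℤ) : ℝ) ≤ (418577 : ℕ) := by
    rw [discr_eq_twentyeight hθ h3]
    norm_num
  have hfloor := floor_minkowskiBound_le_cubic_real h3 (nrComplexPlaces_eq_zero_of_csPoly hθ h3 (by norm_num))
    hd (s := 647) (U := 143) (by norm_num) (by norm_num) (by norm_num)
  have htop : H = ⊤ := by
    refine classGroup_subgroup_eq_top_of_primesOver H hfloor fun p hp hprime P hP0 hP hle => ?_
    have hpU : p ≤ 143 := (Finset.mem_Icc.mp hp).2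
    have h1p : 1 ≤ p := (Finset.mem_Icc.mp hp).1
    interval_cases p
    · exact absurd hprime (by norm_num)
    · exact hprinc P hP0 _ (eq_span_of_inert_twentyeight hθ h3 (by norm_num) hP)
    · -- `p = 3`
      rcases eq_P3_or_eq_Q3_twentyeight hθ h3 hP with h | h <;> subst h
      · rw [show ClassGroup.mk0 ⟨_, hP0⟩ = ClassGroup.mk0 ⟨span {(3 : 𝓞 K), thetaInt hθ - 2}, (span_pair_ofNat_mem_nonZeroDivisors (nat_lit 3) (thetaInt hθ - 2))⟩ from rfl, ha]
        exact Subgroup.mem_zpowers a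
      · exact mem_zpowers_of_mk0_eq a (cls_Q3_twentyeight hθ) ha
    · exact absurd hprime (by norm_num)
    · -- `p = 5`
      rcases eq_P5_or_eq_Q5_twentyeight hθ h3 hP with h | h <;> subst h
      · exact mem_zpowers_of_mk0_eq a (cls_P5_3_twentyeight hθ) ha
      · exact mem_zpowers_of_mk0_eq a (cls_Q5_twentyeight hθ) ha
    · exact absurd hprime (by norm_num)
    · -- `p = 7`
      rcases eq_P7_or_eq_Q7_twentyeight hθ h3 hP with h | h <;> subst h
      · exact mem_zpowers_of_mk0_eq a (cls_P7_5_twentyeight hθ) ha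
      · exact mem_zpowers_of_mk0_eq a (cls_Q7_twentyeight hθ) ha
    · exact absurd hprime (by norm_num)
    · exact absurd hprime (by norm_num)
    · exact absurd hprime (by norm_num)
    · exact hprinc P hP0 _ (eq_span_of_inert_twentyeight hθ h3 (by norm_num) hP)
    · exact absurd hprime (by norm_num)
    · exact hprinc P hP0 _ (eq_span_of_inert_twentyeight hθ h3 (by norm_num) hP)
    · exact absurd hprime (by norm_num)
    · exact absurd hprime (by norm_num)
    · exact absurd hprime (by norm_num)
    · -- `p = 17`
      have h := eq_span_pair_of_unique_root_twentyeight hθ h3 (Or.inl ⟨rfl, rfl⟩) hP hle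
      simp only [Nat.cast_ofNat, Int.cast_ofNat] at h
      subst h
      exact mem_zpowers_of_mk0_eq a (cls_P17_2_twentyeight hθ) ha
    · exact absurd hprime (by norm_num)
    · -- `p = 19` (splits)
      rcases eq_P19_twentyeight hθ h3 hP with h | h | h <;> subst h
      · exact mem_zpowers_of_mk0_eq a (cls_P19_13_twentyeight hθ) ha
      · exact mem_zpowers_of_mk0_eq a (cls_P19_16_twentyeight hθ) ha
      · exact mem_zpowers_of_mk0_eq a (cls_P19_18_twentyeight hθ) ha
    · exact absurd hprime (by norm_num)
    · exact absurd hprime (by norm_num)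
    · exact absurd hprime (by norm_num)
    · -- `p = 23` (ramified)
      rcases eq_P23_twentyeight hθ h3 hP with h | h | h <;> subst h
      · exact mem_zpowers_of_mk0_eq a (cls_P23_13_twentyeight hθ) ha
      · exact mem_zpowers_of_mk0_eq a (cls_P23_19_twentyeight hθ) ha
      · exact mem_zpowers_of_mk0_eq a (cls_P23_19_twentyeight hθ) ha
    · exact absurd hprime (by norm_num)
    · exact absurd hprime (by norm_num)
    · exact absurd hprime (by norm_num)
    · exact absurd hprime (by norm_num)
    · exact absurd hprime (by norm_num)
    · -- `p = 29` (splits)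
      rcases eq_P29_twentyeight hθ h3 hP with h | h | h <;> subst h
      · exact mem_zpowers_of_mk0_eq a (cls_P29_3_twentyeight hθ) ha
      · exact mem_zpowers_of_mk0_eq a (cls_P29_7_twentyeight hθ) ha
      · exact mem_zpowers_of_mk0_eq a (cls_P29_18_twentyeight hθ) ha
    · exact absurd hprime (by norm_num)
    · -- `p = 31`
      have h := eq_span_pair_of_unique_root_twentyeight hθ h3 (Or.inr (Or.inl ⟨rfl, rfl⟩)) hP hle
      simp only [Nat.cast_ofNat, Int.cast_ofNat] at h
      subst h
      exact mem_zpowers_of_mk0_eq a (cls_P31_26_twentyeight hθ) ha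
    · exact absurd hprime (by norm_num)
    · exact absurd hprime (by norm_num)
    · exact absurd hprime (by norm_num)
    · exact absurd hprime (by norm_num)
    · exact absurd hprime (by norm_num)
    · exact hprinc P hP0 _ (eq_span_of_inert_twentyeight hθ h3 (by norm_num) hP)
    · exact absurd hprime (by norm_num)
    · exact absurd hprime (by norm_num)
    · exact absurd hprime (by norm_num)
    · exact hprinc P hP0 _ (eq_span_of_inert_twentyeight hθ h3 (by norm_num) hP)
    · exact absurd hprime (by norm_num)
    · exact hprinc P hP0 _ (eq_span_of_inert_twentyeight hθ h3 (by norm_num) hP)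
    · exact absurd hprime (by norm_num)
    · exact absurd hprime (by norm_num)
    · exact absurd hprime (by norm_num)
    · exact hprinc P hP0 _ (eq_span_of_inert_twentyeight hθ h3 (by norm_num) hP)
    · exact absurd hprime (by norm_num)
    · exact absurd hprime (by norm_num)
    · exact absurd hprime (by norm_num)
    · exact absurd hprime (by norm_num)
    · exact absurd hprime (by norm_num)
    · exact hprinc P hP0 _ (eq_span_of_inert_twentyeight hθ h3 (by norm_num) hP)
    · exact absurd hprime (by norm_num)
    · exact absurd hprime (by norm_num)
    · exact absurd hprime (by norm_num)
    · exact absurd hprime (by norm_num)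
    · exact absurd hprime (by norm_num)
    · -- `p = 59`
      have h := eq_span_pair_of_unique_root_twentyeight hθ h3 (Or.inr (Or.inr (Or.inl ⟨rfl, rfl⟩))) hP hle
      simp only [Nat.cast_ofNat, Int.cast_ofNat] at h
      subst h
      exact mem_zpowers_of_mk0_eq a (cls_P59_49_twentyeight hθ) ha
    · exact absurd hprime (by norm_num)
    · exact hprinc P hP0 _ (eq_span_of_inert_twentyeight hθ h3 (by norm_num) hP)
    · exact absurd hprime (by norm_num)
    · exact absurd hprime (by norm_num)
    · exact absurd hprime (by norm_num)
    · exact absurd hprime (by norm_num)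
    · exact absurd hprime (by norm_num)
    · -- `p = 67`
      have h := eq_span_pair_of_unique_root_twentyeight hθ h3 (Or.inr (Or.inr (Or.inr (Or.inl ⟨rfl, rfl⟩)))) hP hle
      simp only [Nat.cast_ofNat, Int.cast_ofNat] at h
      subst h
      exact mem_zpowers_of_mk0_eq a (cls_P67_46_twentyeight hθ) ha
    · exact absurd hprime (by norm_num)
    · exact absurd hprime (by norm_num)
    · exact absurd hprime (by norm_num)
    · -- `p = 71` (splits)
      rcases eq_P71_twentyeight hθ h3 hP with h | h | h <;> subst h
      · exact mem_zpowers_of_mk0_eq a (cls_P71_8_twentyeight hθ) ha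
      · exact mem_zpowers_of_mk0_eq a (cls_P71_44_twentyeight hθ) ha
      · exact mem_zpowers_of_mk0_eq a (cls_P71_47_twentyeight hθ) ha
    · exact absurd hprime (by norm_num)
    · -- `p = 73`
      have h := eq_span_pair_of_unique_root_twentyeight hθ h3 (Or.inr (Or.inr (Or.inr (Or.inr (Or.inl ⟨rfl, rfl⟩))))) hP hle
      simp only [Nat.cast_ofNat, Int.cast_ofNat] at h
      subst h
      exact mem_zpowers_of_mk0_eq a (cls_P73_67_twentyeight hθ) ha
    · exact absurd hprime (by norm_num)
    · exact absurd hprime (by norm_num)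
    · exact absurd hprime (by norm_num)
    · exact absurd hprime (by norm_num)
    · exact absurd hprime (by norm_num)
    · -- `p = 79`
      have h := eq_span_pair_of_unique_root_twentyeight hθ h3 (Or.inr (Or.inr (Or.inr (Or.inr (Or.inr (Or.inl ⟨rfl, rfl⟩)))))) hP hle
      simp only [Nat.cast_ofNat, Int.cast_ofNat] at h
      subst h
      exact mem_zpowers_of_mk0_eq a (cls_P79_65_twentyeight hθ) ha
    · exact absurd hprime (by norm_num)
    · exact absurd hprime (by norm_num)
    · exact absurd hprime (by norm_num)
    · -- `p = 83`
      have h := eq_span_pair_of_unique_root_twentyeight hθ h3 (Or.inr (Or.inr (Or.inr (Or.inr (Or.inr (Or.inr (Or.inl ⟨rfl, rfl⟩))))))) hP hle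
      simp only [Nat.cast_ofNat, Int.cast_ofNat] at h
      subst h
      exact mem_zpowers_of_mk0_eq a (cls_P83_54_twentyeight hθ) ha
    · exact absurd hprime (by norm_num)
    · exact absurd hprime (by norm_num)
    · exact absurd hprime (by norm_num)
    · exact absurd hprime (by norm_num)
    · exact absurd hprime (by norm_num)
    · exact hprinc P hP0 _ (eq_span_of_inert_twentyeight hθ h3 (by norm_num) hP)
    · exact absurd hprime (by norm_num)
    · exact absurd hprime (by norm_num)
    · exact absurd hprime (by norm_num)
    · exact absurd hprime (by norm_num)
    · exact absurd hprime (by norm_num)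
    · exact absurd hprime (by norm_num)
    · exact absurd hprime (by norm_num)
    · exact hprinc P hP0 _ (eq_span_of_inert_twentyeight hθ h3 (by norm_num) hP)
    · exact absurd hprime (by norm_num)
    · exact absurd hprime (by norm_num)
    · exact absurd hprime (by norm_num)
    · exact hprinc P hP0 _ (eq_span_of_inert_twentyeight hθ h3 (by norm_num) hP)
    · exact absurd hprime (by norm_num)
    · -- `p = 103`
      have h := eq_span_pair_of_unique_root_twentyeight hθ h3 (Or.inr (Or.inr (Or.inr (Or.inr (Or.inr (Or.inr (Or.inr (Or.inl ⟨rfl, rfl⟩)))))))) hP hle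
      simp only [Nat.cast_ofNat, Int.cast_ofNat] at h
      subst h
      exact mem_zpowers_of_mk0_eq a (cls_P103_58_twentyeight hθ) ha
    · exact absurd hprime (by norm_num)
    · exact absurd hprime (by norm_num)
    · exact absurd hprime (by norm_num)
    · exact hprinc P hP0 _ (eq_span_of_inert_twentyeight hθ h3 (by norm_num) hP)
    · exact absurd hprime (by norm_num)
    · -- `p = 109`
      have h := eq_span_pair_of_unique_root_twentyeight hθ h3 (Or.inr (Or.inr (Or.inr (Or.inr (Or.inr (Or.inr (Or.inr (Or.inr (Or.inl ⟨rfl, rfl⟩))))))))) hP hle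
      simp only [Nat.cast_ofNat, Int.cast_ofNat] at h
      subst h
      exact mem_zpowers_of_mk0_eq a (cls_P109_95_twentyeight hθ) ha
    · exact absurd hprime (by norm_num)
    · exact absurd hprime (by norm_num)
    · exact absurd hprime (by norm_num)
    · exact hprinc P hP0 _ (eq_span_of_inert_twentyeight hθ h3 (by norm_num) hP)
    · exact absurd hprime (by norm_num)
    · exact absurd hprime (by norm_num)
    · exact absurd hprime (by norm_num)
    · exact absurd hprime (by norm_num)
    · exact absurd hprime (by norm_num)
    · exact absurd hprime (by norm_num)
    · exact absurd hprime (by norm_num)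
    · exact absurd hprime (by norm_num)
    · exact absurd hprime (by norm_num)
    · exact absurd hprime (by norm_num)
    · exact absurd hprime (by norm_num)
    · exact absurd hprime (by norm_num)
    · exact absurd hprime (by norm_num)
    · -- `p = 127`
      have h := eq_span_pair_of_unique_root_twentyeight hθ h3 (Or.inr (Or.inr (Or.inr (Or.inr (Or.inr (Or.inr (Or.inr (Or.inr (Or.inr (Or.inl ⟨rfl, rfl⟩)))))))))) hP hle
      simp only [Nat.cast_ofNat, Int.cast_ofNat] at h
      subst h
      exact mem_zpowers_of_mk0_eq a (cls_P127_120_twentyeight hθ) ha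
    · exact absurd hprime (by norm_num)
    · exact absurd hprime (by norm_num)
    · exact absurd hprime (by norm_num)
    · -- `p = 131`
      have h := eq_span_pair_of_unique_root_twentyeight hθ h3 (Or.inr (Or.inr (Or.inr (Or.inr (Or.inr (Or.inr (Or.inr (Or.inr (Or.inr (Or.inr (Or.inl ⟨rfl, rfl⟩))))))))))) hP hle
      simp only [Nat.cast_ofNat, Int.cast_ofNat] at h
      subst h
      exact hprinc _ hP0 _ (P131_88_eq_twentyeight hθ)
    · exact absurd hprime (by norm_num)
    · exact absurd hprime (by norm_num)
    · exact absurd hprime (by norm_num)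
    · exact absurd hprime (by norm_num)
    · exact absurd hprime (by norm_num)
    · -- `p = 137`
      have h := eq_span_pair_of_unique_root_twentyeight hθ h3 (Or.inr (Or.inr (Or.inr (Or.inr (Or.inr (Or.inr (Or.inr (Or.inr (Or.inr (Or.inr (Or.inr (Or.inl ⟨rfl, rfl⟩)))))))))))) hP hle
      simp only [Nat.cast_ofNat, Int.cast_ofNat] at h
      subst h
      exact mem_zpowers_of_mk0_eq a (cls_P137_55_twentyeight hθ) ha
    · exact absurd hprime (by norm_num)
    · -- `p = 139`
      have h := eq_span_pair_of_unique_root_twentyeight hθ h3 (Or.inr (Or.inr (Or.inr (Or.inr (Or.inr (Or.inr (Or.inr (Or.inr (Or.inr (Or.inr (Or.inr (Or.inr (⟨rfl, rfl⟩))))))))))))) hP hle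
      simp only [Nat.cast_ofNat, Int.cast_ofNat] at h
      subst h
      exact mem_zpowers_of_mk0_eq a (cls_P139_16_twentyeight hθ) ha
    · exact absurd hprime (by norm_num)
    · exact absurd hprime (by norm_num)
    · exact absurd hprime (by norm_num)
    · exact absurd hprime (by norm_num)
  have hC : C ∈ H := by rw [htop]; exact Subgroup.mem_top C
  obtain ⟨k, rfl⟩ := Subgroup.mem_zpowers_iff.mp hC
  obtain ⟨q, r, hr, rfl⟩ : ∃ q r : ℤ, (r = 0 ∨ r = 1 ∨ r = 2 ∨ r = 3 ∨ r = 4 ∨ r = 5 ∨ r = 6 ∨ r = 7 ∨ r = 8 ∨ r = 9) ∧ k = 10 * q + r :=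
    ⟨k / 10, k % 10, by omega, by omega⟩
  rw [zpow_add, zpow_mul, ham, one_zpow, one_mul]
  rcases hr with rfl | rfl | rfl | rfl | rfl | rfl | rfl | rfl | rfl | rfl
  · exact Or.inl (zpow_zero a)
  · right; left
    rw [show (1 : ℤ) = 1 + 10 * (0) by norm_num, zpow_add, zpow_mul, ham, one_zpow, mul_one,
      zpow_one, ← ha]
  · right; right; left
    rw [show (2 : ℤ) = 2 + 10 * (0) by norm_num, zpow_add, zpow_mul, ham, one_zpow, mul_one,
      ← ha, ← cls_P29_3_twentyeight hθ]
  · right; right; right; left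
    rw [show (3 : ℤ) = 3 + 10 * (0) by norm_num, zpow_add, zpow_mul, ham, one_zpow, mul_one,
      ← ha, ← cls_P29_18_twentyeight hθ]
  · right; right; right; right; left
    rw [show (4 : ℤ) = 4 + 10 * (0) by norm_num, zpow_add, zpow_mul, ham, one_zpow, mul_one,
      ← ha, ← cls_P7_5_twentyeight hθ]
  · right; right; right; right; right; left
    rw [show (5 : ℤ) = -5 + 10 * (1) by norm_num, zpow_add, zpow_mul, ham, one_zpow, mul_one,
      ← ha, ← cls_P19_16_twentyeight hθ]
  · right; right; right; right; right; right; left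
    rw [show (6 : ℤ) = -4 + 10 * (1) by norm_num, zpow_add, zpow_mul, ham, one_zpow, mul_one,
      ← ha, ← cls_P19_13_twentyeight hθ]
  · right; right; right; right; right; right; right; left
    rw [show (7 : ℤ) = -3 + 10 * (1) by norm_num, zpow_add, zpow_mul, ham, one_zpow, mul_one,
      ← ha, ← cls_P23_19_twentyeight hθ]
  · right; right; right; right; right; right; right; right; left
    rw [show (8 : ℤ) = -2 + 10 * (1) by norm_num, zpow_add, zpow_mul, ham, one_zpow, mul_one,
      ← ha, ← cls_P5_3_twentyeight hθ]
  · right; right; right; right; right; right; right; right; right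
    rw [show (9 : ℤ) = -1 + 10 * (1) by norm_num, zpow_add, zpow_mul, ham, one_zpow, mul_one,
      ← ha, ← cls_P17_2_twentyeight hθ]


end Field


/-! ### The ideal classes of `ℤ[X]/(f₂₈)` and Gompf's conjecture for the traces `28` and `-23` -/

section Matrices

set_option maxHeartbeats 1000000 in
/-- **The ideal classes of `ℤ[Θ₂₈] = ℤ[X]/(f₂₈)`**: every non-zero ideal is in the class of one of
`⟨Θ - 1, 1⟩`, `⟨Θ - 2, 3⟩`, `⟨Θ - 3, 29⟩`, `⟨Θ - 18, 29⟩`, `⟨Θ - 5, 7⟩`, `⟨Θ - 16, 19⟩`, `⟨Θ - 13, 19⟩`, `⟨Θ - 19, 23⟩`, `⟨Θ - 3, 5⟩`, `⟨Θ - 2, 17⟩` (these representatives cover `C(ℤ[Θ₂₈])`). [cite: KimYamada2023, §6.1 (proof of Thm. B)] -/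
theorem ideal_class_adjoinRoot_twentyeight (J : Ideal (AdjoinRoot (csPoly 28))) (hJ : J ≠ ⊥) :
    ∃ x y : AdjoinRoot (csPoly 28), x ≠ 0 ∧ y ≠ 0 ∧
      (span {x} * J = span {y} * csIdeal 1 1 28 ∨ span {x} * J = span {y} * csIdeal 2 3 28 ∨ span {x} * J = span {y} * csIdeal 3 29 28 ∨ span {x} * J = span {y} * csIdeal 18 29 28 ∨ span {x} * J = span {y} * csIdeal 5 7 28 ∨ span {x} * J = span {y} * csIdeal 16 19 28 ∨ span {x} * J = span {y} * csIdeal 13 19 28 ∨ span {x} * J = span {y} * csIdeal 19 23 28 ∨ span {x} * J = span {y} * csIdeal 3 5 28 ∨ span {x} * J = span {y} * csIdeal 2 17 28) := by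
  classical
  set θ' := AdjoinRoot.root (csPolyQ 28) with hθ'
  have hθ : aeval θ' (csPoly 28) = 0 := aeval_root_csPoly 28
  have h3 : finrank ℚ (CSField 28) = 3 := finrank_CSField 28
  obtain ⟨e, he⟩ := exists_ringEquiv_adjoinRoot_of_sq hθ h3 csDisc_twentyeight_sq
  set I : Ideal (𝓞 (CSField 28)) := J.map e with hI
  have hIJ : I.map (e.symm : 𝓞 (CSField 28) →+* AdjoinRoot (csPoly 28)) = J := by
    rw [hI]
    exact Ideal.map_of_equiv e (I := J)
  have hI0 : I ≠ ⊥ := by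
    intro h0
    apply hJ
    rw [← hIJ, h0, Ideal.map_bot]
  have hImem : I ∈ (Ideal (𝓞 (CSField 28)))⁰ := mem_nonZeroDivisors_iff_ne_zero.mpr hI0
  have hsymm : ∀ x, (e.symm : 𝓞 (CSField 28) →+* AdjoinRoot (csPoly 28)) (e x) = x :=
    fun x => e.symm_apply_apply x
  have hP3_2 : (span {(3 : 𝓞 (CSField 28)), thetaInt hθ - 2}).map
      (e.symm : 𝓞 (CSField 28) →+* AdjoinRoot (csPoly 28)) = csIdeal 2 3 28 := by
    rw [Ideal.map_span, Set.image_insert_eq, Set.image_singleton, map_sub, ← he, hsymm, map_ofNat,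
      map_ofNat, csIdeal, Set.pair_comm]
    simp
  have hP29_3 : (span {(29 : 𝓞 (CSField 28)), thetaInt hθ - 3}).map
      (e.symm : 𝓞 (CSField 28) →+* AdjoinRoot (csPoly 28)) = csIdeal 3 29 28 := by
    rw [Ideal.map_span, Set.image_insert_eq, Set.image_singleton, map_sub, ← he, hsymm, map_ofNat,
      map_ofNat, csIdeal, Set.pair_comm]
    simp
  have hP29_18 : (span {(29 : 𝓞 (CSField 28)), thetaInt hθ - 18}).map
      (e.symm : 𝓞 (CSField 28) →+* AdjoinRoot (csPoly 28)) = csIdeal 18 29 28 := by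
    rw [Ideal.map_span, Set.image_insert_eq, Set.image_singleton, map_sub, ← he, hsymm, map_ofNat,
      map_ofNat, csIdeal, Set.pair_comm]
    simp
  have hP7_5 : (span {(7 : 𝓞 (CSField 28)), thetaInt hθ - 5}).map
      (e.symm : 𝓞 (CSField 28) →+* AdjoinRoot (csPoly 28)) = csIdeal 5 7 28 := by
    rw [Ideal.map_span, Set.image_insert_eq, Set.image_singleton, map_sub, ← he, hsymm, map_ofNat,
      map_ofNat, csIdeal, Set.pair_comm]
    simp
  have hP19_16 : (span {(19 : 𝓞 (CSField 28)), thetaInt hθ - 16}).map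
      (e.symm : 𝓞 (CSField 28) →+* AdjoinRoot (csPoly 28)) = csIdeal 16 19 28 := by
    rw [Ideal.map_span, Set.image_insert_eq, Set.image_singleton, map_sub, ← he, hsymm, map_ofNat,
      map_ofNat, csIdeal, Set.pair_comm]
    simp
  have hP19_13 : (span {(19 : 𝓞 (CSField 28)), thetaInt hθ - 13}).map
      (e.symm : 𝓞 (CSField 28) →+* AdjoinRoot (csPoly 28)) = csIdeal 13 19 28 := by
    rw [Ideal.map_span, Set.image_insert_eq, Set.image_singleton, map_sub, ← he, hsymm, map_ofNat,
      map_ofNat, csIdeal, Set.pair_comm]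
    simp
  have hP23_19 : (span {(23 : 𝓞 (CSField 28)), thetaInt hθ - 19}).map
      (e.symm : 𝓞 (CSField 28) →+* AdjoinRoot (csPoly 28)) = csIdeal 19 23 28 := by
    rw [Ideal.map_span, Set.image_insert_eq, Set.image_singleton, map_sub, ← he, hsymm, map_ofNat,
      map_ofNat, csIdeal, Set.pair_comm]
    simp
  have hP5_3 : (span {(5 : 𝓞 (CSField 28)), thetaInt hθ - 3}).map
      (e.symm : 𝓞 (CSField 28) →+* AdjoinRoot (csPoly 28)) = csIdeal 3 5 28 := by
    rw [Ideal.map_span, Set.image_insert_eq, Set.image_singleton, map_sub, ← he, hsymm, map_ofNat,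
      map_ofNat, csIdeal, Set.pair_comm]
    simp
  have hP17_2 : (span {(17 : 𝓞 (CSField 28)), thetaInt hθ - 2}).map
      (e.symm : 𝓞 (CSField 28) →+* AdjoinRoot (csPoly 28)) = csIdeal 2 17 28 := by
    rw [Ideal.map_span, Set.image_insert_eq, Set.image_singleton, map_sub, ← he, hsymm, map_ofNat,
      map_ofNat, csIdeal, Set.pair_comm]
    simp
  have hcase : ∀ (P : Ideal (𝓞 (CSField 28))) (hP0 : P ∈ (Ideal (𝓞 (CSField 28)))⁰)
      (Q : Ideal (AdjoinRoot (csPoly 28))),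
      P.map (e.symm : 𝓞 (CSField 28) →+* AdjoinRoot (csPoly 28)) = Q →
      ClassGroup.mk0 ⟨I, hImem⟩ = ClassGroup.mk0 ⟨P, hP0⟩ →
        ∃ x y : AdjoinRoot (csPoly 28), x ≠ 0 ∧ y ≠ 0 ∧ span {x} * J = span {y} * Q := by
    intro P hP0 Q hPQ hcls
    obtain ⟨x, y, hx, hy, hxy⟩ := ClassGroup.mk0_eq_mk0_iff.mp hcls
    refine ⟨(e.symm : 𝓞 (CSField 28) →+* AdjoinRoot (csPoly 28)) x,
      (e.symm : 𝓞 (CSField 28) →+* AdjoinRoot (csPoly 28)) y,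
      (map_ne_zero_iff _ e.symm.injective).mpr hx, (map_ne_zero_iff _ e.symm.injective).mpr hy, ?_⟩
    have h := congrArg (Ideal.map (e.symm : 𝓞 (CSField 28) →+* AdjoinRoot (csPoly 28))) hxy
    simp only [Ideal.map_mul, Ideal.map_span, Set.image_singleton] at h
    rw [hIJ, hPQ] at h
    exact h
  rcases classGroup_mem_twentyeight hθ h3 (ClassGroup.mk0 ⟨I, hImem⟩) with h1 | hcl | hcl | hcl | hcl | hcl | hcl | hcl | hcl | hcl
  · obtain ⟨z, hz⟩ := ((ClassGroup.mk0_eq_one_iff hImem).mp h1).principal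
    have hz' : I = span {z} := by rw [hz, submodule_span_eq]
    have hz0 : z ≠ 0 := by
      rintro rfl
      apply hI0
      rw [hz', Ideal.span_singleton_eq_bot]
    refine ⟨1, (e.symm : 𝓞 (CSField 28) →+* AdjoinRoot (csPoly 28)) z, one_ne_zero,
      (map_ne_zero_iff _ e.symm.injective).mpr hz0, Or.inl ?_⟩
    rw [Ideal.span_singleton_one, Ideal.top_mul, csIdeal_one_one, Ideal.mul_top, ← hIJ, hz',
      Ideal.map_span, Set.image_singleton]
  · obtain ⟨x, y, hx, hy, h⟩ := hcase _ _ _ hP3_2 hcl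
    exact ⟨x, y, hx, hy, Or.inr (Or.inl h)⟩
  · obtain ⟨x, y, hx, hy, h⟩ := hcase _ _ _ hP29_3 hcl
    exact ⟨x, y, hx, hy, Or.inr (Or.inr (Or.inl h))⟩
  · obtain ⟨x, y, hx, hy, h⟩ := hcase _ _ _ hP29_18 hcl
    exact ⟨x, y, hx, hy, Or.inr (Or.inr (Or.inr (Or.inl h)))⟩
  · obtain ⟨x, y, hx, hy, h⟩ := hcase _ _ _ hP7_5 hcl
    exact ⟨x, y, hx, hy, Or.inr (Or.inr (Or.inr (Or.inr (Or.inl h))))⟩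
  · obtain ⟨x, y, hx, hy, h⟩ := hcase _ _ _ hP19_16 hcl
    exact ⟨x, y, hx, hy, Or.inr (Or.inr (Or.inr (Or.inr (Or.inr (Or.inl h)))))⟩
  · obtain ⟨x, y, hx, hy, h⟩ := hcase _ _ _ hP19_13 hcl
    exact ⟨x, y, hx, hy, Or.inr (Or.inr (Or.inr (Or.inr (Or.inr (Or.inr (Or.inl h))))))⟩
  · obtain ⟨x, y, hx, hy, h⟩ := hcase _ _ _ hP23_19 hcl
    exact ⟨x, y, hx, hy, Or.inr (Or.inr (Or.inr (Or.inr (Or.inr (Or.inr (Or.inr (Or.inl h)))))))⟩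
  · obtain ⟨x, y, hx, hy, h⟩ := hcase _ _ _ hP5_3 hcl
    exact ⟨x, y, hx, hy, Or.inr (Or.inr (Or.inr (Or.inr (Or.inr (Or.inr (Or.inr (Or.inr (Or.inl h))))))))⟩
  · obtain ⟨x, y, hx, hy, h⟩ := hcase _ _ _ hP17_2 hcl
    exact ⟨x, y, hx, hy, Or.inr (Or.inr (Or.inr (Or.inr (Or.inr (Or.inr (Or.inr (Or.inr (Or.inr (h)))))))))⟩

/-- `3 ∣ f₂₈(2)`: `(2, 3, 28) ∈ 𝒞𝒮`. [cite: KimYamada2023, §6.1 (proof of Thm. B)] -/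
theorem rep0_dvd_eval_csPoly_twentyeight : (3 : ℤ) ∣ (csPoly 28).eval 2 := by
  rw [eval_csPoly]; norm_num

/-- `29 ∣ f₂₈(3)`: `(3, 29, 28) ∈ 𝒞𝒮`. [cite: KimYamada2023, §6.1 (proof of Thm. B)] -/
theorem rep1_dvd_eval_csPoly_twentyeight : (29 : ℤ) ∣ (csPoly 28).eval 3 := by
  rw [eval_csPoly]; norm_num

/-- `29 ∣ f₂₈(18)`: `(18, 29, 28) ∈ 𝒞𝒮`. [cite: KimYamada2023, §6.1 (proof of Thm. B)] -/
theorem rep2_dvd_eval_csPoly_twentyeight : (29 : ℤ) ∣ (csPoly 28).eval 18 := by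
  rw [eval_csPoly]; norm_num

/-- `7 ∣ f₂₈(5)`: `(5, 7, 28) ∈ 𝒞𝒮`. [cite: KimYamada2023, §6.1 (proof of Thm. B)] -/
theorem rep3_dvd_eval_csPoly_twentyeight : (7 : ℤ) ∣ (csPoly 28).eval 5 := by
  rw [eval_csPoly]; norm_num

/-- `19 ∣ f₂₈(16)`: `(16, 19, 28) ∈ 𝒞𝒮`. [cite: KimYamada2023, §6.1 (proof of Thm. B)] -/
theorem rep4_dvd_eval_csPoly_twentyeight : (19 : ℤ) ∣ (csPoly 28).eval 16 := by
  rw [eval_csPoly]; norm_num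

/-- `19 ∣ f₂₈(13)`: `(13, 19, 28) ∈ 𝒞𝒮`. [cite: KimYamada2023, §6.1 (proof of Thm. B)] -/
theorem rep5_dvd_eval_csPoly_twentyeight : (19 : ℤ) ∣ (csPoly 28).eval 13 := by
  rw [eval_csPoly]; norm_num

/-- `23 ∣ f₂₈(19)`: `(19, 23, 28) ∈ 𝒞𝒮`. [cite: KimYamada2023, §6.1 (proof of Thm. B)] -/
theorem rep6_dvd_eval_csPoly_twentyeight : (23 : ℤ) ∣ (csPoly 28).eval 19 := by
  rw [eval_csPoly]; norm_num

/-- `5 ∣ f₂₈(3)`: `(3, 5, 28) ∈ 𝒞𝒮`. [cite: KimYamada2023, §6.1 (proof of Thm. B)] -/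
theorem rep7_dvd_eval_csPoly_twentyeight : (5 : ℤ) ∣ (csPoly 28).eval 3 := by
  rw [eval_csPoly]; norm_num

/-- `17 ∣ f₂₈(2)`: `(2, 17, 28) ∈ 𝒞𝒮`. [cite: KimYamada2023, §6.1 (proof of Thm. B)] -/
theorem rep8_dvd_eval_csPoly_twentyeight : (17 : ℤ) ∣ (csPoly 28).eval 2 := by
  rw [eval_csPoly]; norm_num

/-- **Every Cappell–Shaneson matrix of trace `28` is similar to one of 10 standard matrices**
(Prop. 2.14). [cite: KimYamada2023, §6.1 (proof of Thm. B) and Prop. 2.14] -/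
theorem isConj_standardCSMatrix_of_trace_eq_twentyeight (A : SL(3, ℤ))
    (hdet : ((A : Matrix (Fin 3) (Fin 3) ℤ) - 1).det = 1)
    (htr : Matrix.trace (A : Matrix (Fin 3) (Fin 3) ℤ) = 28) :
    IsConj A (standardCSMatrix 1 1 28 (one_dvd _)) ∨
      IsConj A (standardCSMatrix 2 3 28 rep0_dvd_eval_csPoly_twentyeight) ∨
      IsConj A (standardCSMatrix 3 29 28 rep1_dvd_eval_csPoly_twentyeight) ∨
      IsConj A (standardCSMatrix 18 29 28 rep2_dvd_eval_csPoly_twentyeight) ∨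
      IsConj A (standardCSMatrix 5 7 28 rep3_dvd_eval_csPoly_twentyeight) ∨
      IsConj A (standardCSMatrix 16 19 28 rep4_dvd_eval_csPoly_twentyeight) ∨
      IsConj A (standardCSMatrix 13 19 28 rep5_dvd_eval_csPoly_twentyeight) ∨
      IsConj A (standardCSMatrix 19 23 28 rep6_dvd_eval_csPoly_twentyeight) ∨
      IsConj A (standardCSMatrix 3 5 28 rep7_dvd_eval_csPoly_twentyeight) ∨
      IsConj A (standardCSMatrix 2 17 28 rep8_dvd_eval_csPoly_twentyeight) := by
  have hcover : ∀ J : Ideal (AdjoinRoot (csPoly 28)), J ≠ ⊥ →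
      ∃ (c d : ℤ) (_ : d ∣ (csPoly 28).eval c) (x y : AdjoinRoot (csPoly 28)),
        x ≠ 0 ∧ y ≠ 0 ∧ Ideal.span {x} * J = Ideal.span {y} * csIdeal c d 28 ∧
          ((c = 1 ∧ d = 1) ∨ (c = 2 ∧ d = 3) ∨ (c = 3 ∧ d = 29) ∨ (c = 18 ∧ d = 29) ∨ (c = 5 ∧ d = 7) ∨ (c = 16 ∧ d = 19) ∨ (c = 13 ∧ d = 19) ∨ (c = 19 ∧ d = 23) ∨ (c = 3 ∧ d = 5) ∨ (c = 2 ∧ d = 17)) := by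
    intro J hJ
    obtain ⟨x, y, hx, hy, hxy⟩ := ideal_class_adjoinRoot_twentyeight J hJ
    rcases hxy with h0 | h1 | h2 | h3 | h4 | h5 | h6 | h7 | h8 | h9
    · exact ⟨1, 1, one_dvd _, x, y, hx, hy, h0, Or.inl ⟨rfl, rfl⟩⟩
    · exact ⟨2, 3, rep0_dvd_eval_csPoly_twentyeight, x, y, hx, hy, h1, Or.inr (Or.inl ⟨rfl, rfl⟩)⟩
    · exact ⟨3, 29, rep1_dvd_eval_csPoly_twentyeight, x, y, hx, hy, h2, Or.inr (Or.inr (Or.inl ⟨rfl, rfl⟩))⟩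
    · exact ⟨18, 29, rep2_dvd_eval_csPoly_twentyeight, x, y, hx, hy, h3, Or.inr (Or.inr (Or.inr (Or.inl ⟨rfl, rfl⟩)))⟩
    · exact ⟨5, 7, rep3_dvd_eval_csPoly_twentyeight, x, y, hx, hy, h4, Or.inr (Or.inr (Or.inr (Or.inr (Or.inl ⟨rfl, rfl⟩))))⟩
    · exact ⟨16, 19, rep4_dvd_eval_csPoly_twentyeight, x, y, hx, hy, h5, Or.inr (Or.inr (Or.inr (Or.inr (Or.inr (Or.inl ⟨rfl, rfl⟩)))))⟩
    · exact ⟨13, 19, rep5_dvd_eval_csPoly_twentyeight, x, y, hx, hy, h6, Or.inr (Or.inr (Or.inr (Or.inr (Or.inr (Or.inr (Or.inl ⟨rfl, rfl⟩))))))⟩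
    · exact ⟨19, 23, rep6_dvd_eval_csPoly_twentyeight, x, y, hx, hy, h7, Or.inr (Or.inr (Or.inr (Or.inr (Or.inr (Or.inr (Or.inr (Or.inl ⟨rfl, rfl⟩)))))))⟩
    · exact ⟨3, 5, rep7_dvd_eval_csPoly_twentyeight, x, y, hx, hy, h8, Or.inr (Or.inr (Or.inr (Or.inr (Or.inr (Or.inr (Or.inr (Or.inr (Or.inl ⟨rfl, rfl⟩))))))))⟩
    · exact ⟨2, 17, rep8_dvd_eval_csPoly_twentyeight, x, y, hx, hy, h9, Or.inr (Or.inr (Or.inr (Or.inr (Or.inr (Or.inr (Or.inr (Or.inr (Or.inr (⟨rfl, rfl⟩)))))))))⟩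
  obtain ⟨c, d, h, hconj, hcd⟩ := exists_isConj_standardCSMatrix_of_cover _ hcover A hdet htr
  rcases hcd with ⟨rfl, rfl⟩ | ⟨rfl, rfl⟩ | ⟨rfl, rfl⟩ | ⟨rfl, rfl⟩ | ⟨rfl, rfl⟩ | ⟨rfl, rfl⟩ | ⟨rfl, rfl⟩ | ⟨rfl, rfl⟩ | ⟨rfl, rfl⟩ | ⟨rfl, rfl⟩
  · exact Or.inl hconj
  · exact Or.inr (Or.inl hconj)
  · exact Or.inr (Or.inr (Or.inl hconj))
  · exact Or.inr (Or.inr (Or.inr (Or.inl hconj)))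
  · exact Or.inr (Or.inr (Or.inr (Or.inr (Or.inl hconj))))
  · exact Or.inr (Or.inr (Or.inr (Or.inr (Or.inr (Or.inl hconj)))))
  · exact Or.inr (Or.inr (Or.inr (Or.inr (Or.inr (Or.inr (Or.inl hconj))))))
  · exact Or.inr (Or.inr (Or.inr (Or.inr (Or.inr (Or.inr (Or.inr (Or.inl hconj)))))))
  · exact Or.inr (Or.inr (Or.inr (Or.inr (Or.inr (Or.inr (Or.inr (Or.inr (Or.inl hconj))))))))
  · exact Or.inr (Or.inr (Or.inr (Or.inr (Or.inr (Or.inr (Or.inr (Or.inr (Or.inr (hconj)))))))))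

/-- **Kim–Yamada 2023, Theorem B for the trace `28`, PROVED**: the non-trivial classes move by
Gompf moves to the traces `1` (from `(2, 3, 28)`), `-1` (from `(3, 29, 28)`), `-1` (from `(18, 29, 28)`), `0` (from `(5, 7, 28)`), `9` (from `(16, 19, 28)`), `9` (from `(13, 19, 28)`), `5` (from `(19, 23, 28)`), `-2` (from `(3, 5, 28)`), `-6` (from `(2, 17, 28)`), where Gompf's conjecture holds. [cite: KimYamada2023, Thm. B, Lemma 6.1 and §6.1] -/
theorem gompfConjectureForTrace_twentyeight : GompfConjectureForTrace 28 := by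
  intro A hdet htr
  rcases isConj_standardCSMatrix_of_trace_eq_twentyeight A hdet htr with h0 | h1 | h2 | h3 | h4 | h5 | h6 | h7 | h8 | h9
  · exact (GompfEquiv.of_isConj h0).trans (gompfEquiv_standardCSMatrix_one_one 26 (one_dvd _))
  · exact (GompfEquiv.of_isConj h1).trans
      (gompfEquiv_standardCSMatrix_akbulutKirbyMatrix_of_modEq
        (gompfConjectureForTrace_of_mem_Icc_neg_seven_twelve (by norm_num)) rep0_dvd_eval_csPoly_twentyeight
        (show (28 : ℤ) ≡ 1 [ZMOD 3] by decide))
  · exact (GompfEquiv.of_isConj h2).trans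
      (gompfEquiv_standardCSMatrix_akbulutKirbyMatrix_of_modEq
        (gompfConjectureForTrace_of_mem_Icc_neg_seven_twelve (by norm_num)) rep1_dvd_eval_csPoly_twentyeight
        (show (28 : ℤ) ≡ -1 [ZMOD 29] by decide))
  · exact (GompfEquiv.of_isConj h3).trans
      (gompfEquiv_standardCSMatrix_akbulutKirbyMatrix_of_modEq
        (gompfConjectureForTrace_of_mem_Icc_neg_seven_twelve (by norm_num)) rep2_dvd_eval_csPoly_twentyeight
        (show (28 : ℤ) ≡ -1 [ZMOD 29] by decide))
  · exact (GompfEquiv.of_isConj h4).trans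
      (gompfEquiv_standardCSMatrix_akbulutKirbyMatrix_of_modEq
        (gompfConjectureForTrace_of_mem_Icc_neg_seven_twelve (by norm_num)) rep3_dvd_eval_csPoly_twentyeight
        (show (28 : ℤ) ≡ 0 [ZMOD 7] by decide))
  · exact (GompfEquiv.of_isConj h5).trans
      (gompfEquiv_standardCSMatrix_akbulutKirbyMatrix_of_modEq
        (gompfConjectureForTrace_of_mem_Icc_neg_seven_twelve (by norm_num)) rep4_dvd_eval_csPoly_twentyeight
        (show (28 : ℤ) ≡ 9 [ZMOD 19] by decide))
  · exact (GompfEquiv.of_isConj h6).trans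
      (gompfEquiv_standardCSMatrix_akbulutKirbyMatrix_of_modEq
        (gompfConjectureForTrace_of_mem_Icc_neg_seven_twelve (by norm_num)) rep5_dvd_eval_csPoly_twentyeight
        (show (28 : ℤ) ≡ 9 [ZMOD 19] by decide))
  · exact (GompfEquiv.of_isConj h7).trans
      (gompfEquiv_standardCSMatrix_akbulutKirbyMatrix_of_modEq
        (gompfConjectureForTrace_of_mem_Icc_neg_seven_twelve (by norm_num)) rep6_dvd_eval_csPoly_twentyeight
        (show (28 : ℤ) ≡ 5 [ZMOD 23] by decide))
  · exact (GompfEquiv.of_isConj h8).trans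
      (gompfEquiv_standardCSMatrix_akbulutKirbyMatrix_of_modEq
        (gompfConjectureForTrace_of_mem_Icc_neg_seven_twelve (by norm_num)) rep7_dvd_eval_csPoly_twentyeight
        (show (28 : ℤ) ≡ -2 [ZMOD 5] by decide))
  · exact (GompfEquiv.of_isConj h9).trans
      (gompfEquiv_standardCSMatrix_akbulutKirbyMatrix_of_modEq
        (gompfConjectureForTrace_of_mem_Icc_neg_seven_twelve (by norm_num)) rep8_dvd_eval_csPoly_twentyeight
        (show (28 : ℤ) ≡ -6 [ZMOD 17] by decide))

/-- **Theorem B for the trace `-23`** (`= 5 - 28`), by Theorem A. [cite: KimYamada2023, Thm. A and Thm. B] -/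
theorem gompfConjectureForTrace_neg_twentythree : GompfConjectureForTrace (-23) := by
  have h := gompfConjectureForTrace_of_five_sub gompfConjectureForTrace_twentyeight
  norm_num at h
  exact h

end Matrices


end Literature.Topology.FourManifolds

end
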